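import Literature.MathematicalPhysics.QuantumFieldTheory.Balaban1983to89.B9Eq3126QG1QLowerDiagonalClosed
import Literature.MathematicalPhysics.QuantumFieldTheory.Balaban1983to89.B9Thm311LaplaceAkPositiveDiagonal
import Literature.MathematicalPhysics.QuantumFieldTheory.Balaban1983to89.B9Eq365QGGQLowerVariationalWindowTowerDiagonal
import Literature.MathematicalPhysics.QuantumFieldTheory.Balaban1983to89.B9Thm311SitePrimeFormCoerciveTowerCanonical
import Literature.MathematicalPhysics.QuantumFieldTheory.Balaban1983to89.B9Ineq369CurvatureSmall

/-!
# `Balaban1983to89.B9Eq3126H1RowLettersDiagonalClosed` — T. Bałaban, *Propagators for lattice gauge theories in a background field*, Commun. Math. Phys.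
# **99** (1985) 389–434 [Balaban1985BackgroundPropagators] Thm 3.11 p. 416 («There exist positive constants α₀, γ₀ such that for U satisfying (3.79) with
# arbitrary α₁ ≤ α₀ … the operators Δ′_a, G′, (Q′G′²Q′*)⁻¹, Δ_a, G are positive definite … uniformly bounded»), (3.79) p. 406, (3.35)–(3.37) p. 396, (3.24)–(3.26)
# pp. 394–395, (3.19) p. 393, (3.69) p. 404, (3.126) p. 420, with [Balaban1985Variational] (45) p. 285: **THE SIX LETTERS OF THE TOWER `H₁` ROW OF ROAD ΔA-CT
# — `γ` (coercivity of `Δ_{a,k}(U)`), `μ₁` (the `Q_kG₁,kQ_k†` floor), `hpos′` + `κ₁` (positivity of `Δ′_{a′,k}(U)` and the `Q̃′_kG′_k²Q̃′_k†` floor), `γ′`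
# (coercivity of `Δ′_{a′,k}(U)`), `M` (the `L²` size of `Q̃′_k(U)`), and the curvature letter (`Re U(∂p)`, `Im U(∂p)`, `p_K ≤ p_K⁰`) — SUPPLIED AT ONCE,
# CLOSED, IN ONE COMMON SMALL-FIELD WINDOW ON PRINT's DIAGONAL: `∃ α₀ γ μ₁ γ′ κ₁ M` BEFORE every height `n`, spacing, weights, lattice and background with
# `‖U(b) − 1‖ ≤ αη`, `‖U(∂p) − 1‖ ≤ αη²`, `‖Ū^j(b) − 1‖ ≤ ε_j ≤ αϱ^j`, `α ≤ α₀`** — the OWNER's `exists_coercive_laplaceAk_diagonal_closed`, this lineage's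
# `exists_X1_floor_diagonal_closed` (over ne9-leaf-02's `K`-floor), the KAPPA1 lineage's `exists_qggq_coercive_tower_diagonal_closed`, the OWNER's
# `exists_strong_site_coercive_tower_diagonal` (read through `re_inner_laplacePrimeAk`), the tower `Q̃′_k` letters of `B9Eq319QprimeTowerLipschitzL2` with
# `rhoTower_le_exp_sub_one`, and `B9Ineq369CurvatureSmall` — composed BY NAME, the thresholds met by ONE `min`; the letter half of the fully closed decay row
# of `H₁,k(U)` (sequel: `B9Eq3126H1BlockDecayTowerClosedRadius` consumes exactly these binders)

statement-level skeleton of published theorems with citation tags; proofs where landed; nothing here is a claim about the Yang–Mills mass gap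

CITATION HEADER (lean-in-tree rule).  Audit cell `pub-balaban`, sub-cell `t4`, BINDER row NE9 (road ΔA-CT of the NE9 formalisation swarm, leaf prover 03
`b2b-balaban-t4-ne9-formalise-leaf-03` gen 77).  Imports BY NAME: this lineage's `B9Eq3126QG1QLowerDiagonalClosed`; the OWNER t4-ne9-p1's
`B9Thm311LaplaceAkPositiveDiagonal` and `B9Thm311SitePrimeFormCoerciveTowerCanonical`; the KAPPA1 files' `B9Eq365QGGQLowerVariationalWindowTowerDiagonal`
(ne9-leaf-06 ∕ ne9-leaf-02 lineages); `B9Ineq369CurvatureSmall`; through them `B9Eq319QprimeTowerLipschitzL2`, `B9Eq324DeltaPrimeATower`,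
`B9Eq310HessianHermitian`.  Sources READ first-hand: [Balaban1985BackgroundPropagators] (`paper:balaban1985-cmp99-background-propagators`, journal page = PDF page
+ 388) p. 416 Thm 3.11, p. 406 (3.79), p. 396 (3.35)–(3.37), pp. 393–395 (3.19)–(3.26), p. 404 (3.69), p. 420 (3.126); [Balaban1985Variational] p. 285 (45).
Print states Thm 3.11 with «O(1)» constants by Fourier analysis and the random walk; every constant here is the cell's crude closed form from the named files.

WHAT IS PROVED (sorry-free; proof lane — no `def`; [folklore] composition BY NAME + threshold arithmetic).
* **`exists_H1_row_letters_diagonal_closed`** — for `1 ≤ d`, `3 ≤ L`, the fibre letters `M_φ, M_φ′`, `a > 0`, `a′ > 0`, `0 ≤ ϱ < 1`, a bounded `*`-trace `τ`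
  (`‖τX‖ ≤ C_τ‖X‖`, `τ(X*) = conj τ(X)`, `τ(XY) = τ(YX)`, `⟪φ⁻¹X, φ⁻¹Y⟫ = τ(X*Y)`), `ρ_w ≥ 0`, `M_τ ≥ 0`: `∃ α₀ γ μ₁ γ′ κ₁ M` with `0 < α₀`, `0 < γ ≤ 1`,
  `0 < μ₁`, `0 < γ′ ≤ 1`, `0 < κ₁`, `0 ≤ M`, `768·|DirPair d|·M_τM_φ²ρ_w·α₀ < γ∕2`, such that for every `n`, `η` (`ηL^{n+1} = 1`), `c₀, c₁` (`c₀(L^{n+1})^d = c₁`,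
  `|η|^d∕c₀ ≤ ρ_w`), `m`, `U` with E162's data and level unit-ball, `0 ≤ α ≤ α₀`, unitary, `U(b) ∈ U1`, `‖U(b) − 1‖ ≤ αη`, `‖U(∂p) − 1‖ ≤ αη²`, `ε_j ≤ αϱ^j`:
  (γ) `γ‖x‖² ≤ re⟪x, Δ_{a,k}(U)x⟫`; (μ₁) `∀ hpos hQ g, μ₁‖g‖² ≤ re⟪g, Q_k(G₁,k(Q_k†g))⟫`; (pos′) `Δ′_{a′,k}(U)` positive definite; (γ′) `γ′‖f‖² ≤ ‖D_Uf‖² +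
  a′‖Q̃′_kf‖²`; (κ₁) `∀ hpos′ ψ, κ₁‖ψ‖² ≤ re⟪ψ, Q̃′_kG′_k²Q̃′_k†ψ⟫`; (M) `‖Q̃′_ks‖ ≤ M‖s‖`; (curv) `‖Re U(∂p) − 1‖ ≤ αη²`, `‖Im U(∂p)‖ ≤ αη²`,
  `768·|DirPair d|·M_τM_φ²(‖η^d‖∕c₀)‖η⁻¹‖²(αη²) ≤ 768·|DirPair d|·M_τM_φ²ρ_w·α₀` — the binders `hcoer`, `hX1`, `hpos′`, `coercive`, `hκ`, `hMQ`, `hRe`, `hIm`,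
  `hpK` of `B9Eq3126H1BlockDecayTowerClosedRadius.exists_rate_block_decay_H1k_closed` VERBATIM.
HONEST SCOPE.  Composition + `min`-thresholds; crude constants (the suppliers'); the MODEL letters (E162's `hα1 hU1 hreg`, level windows, unit ball, unitarity,
the trace letters, `|η|^d∕c₀ ≤ ρ_w`) stay displayed — print's running axioms (3.35)–(3.37); NOT print's `γ₀`; NOT NE9 (cell pub-balaban: NE9 NOT PRINTED ∕ NOT
PROVED; «NE9 ⇐ the named binders»; row WALLED ON A MODEL (O-NE9-1; #5 UNRULED); spine PROVED 0∕9; rung (B)+1 on a finite T⁴ — NOT infinite volume, NOT mass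
gap, NOT BetaPertH, NOT Clay; HONEST DEPENDENCY: continuum YM on T⁴ ⇐ BetaPertH ∧ nine spine estimates (0/9 proved); BetaPertH ⇐ (D1) ∧ (D4) ∧ CAP+tail;
G-an2-4 gates asym, D1 and NE2/3/4).  NEW file; nothing modified.  Net new unproved facts: 0.
-/

noncomputable section

open scoped InnerProductSpace ComplexConjugate BigOperators

namespace Literature.MathematicalPhysics.QuantumFieldTheory.Balaban1983to89.B9Eq3126H1RowLettersDiagonalClosed

open B4Sect5Torus (TSite)
open B9SectCLatticeCarrier (Bond DirPair)
open B9Eq311L2Pairing (WL2)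
open B9Eq319QprimeTorus (fineP)
open B11Eq103H1Complex (SiteL2K BondL2K covDerivL2K)
open B9Eq310HessianOperator (adTransportW)
open B9Eq310HessianHermitian (adTransportW_adjoint)
open B9Eq310DeltaPrime (plaqHolU reHol imHol)
open B9Eq315QTower (towerP UlevOf)
open B9Eq315QTorus (perCfg cornerSite)
open B7Prop1Explicit (U1 Wcx boxVec)
open B9Eq326OperatorTower (laplaceAk G1k QkW QprimeTowerW)
open B9Eq324DeltaPrimeATower (laplacePrimeAk GpOfUk re_inner_laplacePrimeAk)
open B9Eq3126QG1QLowerDiagonalClosed (exists_X1_floor_diagonal_closed)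
open B9Thm311LaplaceAkPositiveDiagonal (exists_coercive_laplaceAk_diagonal_closed)
open B9Eq365QGGQLowerVariationalWindowTowerDiagonal (exists_qggq_coercive_tower_diagonal_closed)
open B9Thm311SitePrimeFormCoerciveTowerCanonical (exists_strong_site_coercive_tower_diagonal rhoTower_le_exp_sub_one)
open B9Eq319QprimeTowerLipschitzL2 (norm_QtildeTower_sub_flat_le norm_QtildeTower_one_le)
open B9Ineq369CurvatureSmall (norm_reHol_sub_one_le norm_imHol_le)

variable {d : ℕ} (hd : 1 ≤ d) (L : ℕ) [NeZero L] (hL : 1 ≤ L) (hL3 : 3 ≤ L)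
  {𝔸 : Type*} [NormedRing 𝔸] [NormedAlgebra ℂ 𝔸] [CompleteSpace 𝔸] [NormOneClass 𝔸] [StarRing 𝔸] [NormedStarGroup 𝔸] [StarModule ℂ 𝔸]
  {W : Type*} [NormedAddCommGroup W] [InnerProductSpace ℂ W] [FiniteDimensional ℂ W] (φ : W ≃ₗ[ℂ] 𝔸)
  {Mφ Mφ' : ℝ} (hMφ : 0 ≤ Mφ) (hMφ' : 0 ≤ Mφ') (hφ : ∀ w, ‖φ w‖ ≤ Mφ * ‖w‖) (hφ' : ∀ X, ‖φ.symm X‖ ≤ Mφ' * ‖X‖)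
  {a : ℝ} (ha : 0 < a) {a' : ℝ} (ha' : 0 < a') {ϱ : ℝ} (hϱ0 : 0 ≤ ϱ) (hϱ1 : ϱ < 1)
  (τ : 𝔸 →ₗ[ℂ] ℂ) {Cτ : ℝ} (hτ : ∀ X, ‖τ X‖ ≤ Cτ * ‖X‖) (hCτ : 0 ≤ Cτ) {ρw : ℝ} (hρw : 0 ≤ ρw)
  (hτ₁ : ∀ X : 𝔸, τ (star X) = conj (τ X)) (hτ₂ : ∀ X Y : 𝔸, τ (X * Y) = τ (Y * X))
  (hφτ : ∀ X Y : 𝔸, ⟪φ.symm X, φ.symm Y⟫_ℂ = τ (star X * Y)) {Mτ : ℝ} (hMτ : 0 ≤ Mτ)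

set_option maxHeartbeats 800000 in
include hd hL hL3 hMφ hMφ' hφ hφ' ha ha' hϱ0 hϱ1 hτ hCτ hρw hτ₁ hτ₂ hφτ hMτ in
/-- **THE SIX LETTERS OF THE TOWER `H₁` ROW, CLOSED AT ONCE IN ONE WINDOW ON THE DIAGONAL** (see the module docstring for the list); the thresholds of the
five suppliers and the curvature gap `p_K⁰ < γ∕2` are met by one `α₀ := min …`. [cite: Balaban1985BackgroundPropagators, Thm 3.11 p.416, (3.79) p.406,
(3.35)–(3.37) p.396, (3.24)–(3.26) pp.394–395, (3.69) p.404, (3.126) p.420; Balaban1985Variational, (45) p.285] -/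
theorem exists_H1_row_letters_diagonal_closed :
    ∃ α₀ γ μ₁ γ' κ₁ M : ℝ, 0 < α₀ ∧ 0 < γ ∧ γ ≤ 1 ∧ 0 < μ₁ ∧ 0 < γ' ∧ γ' ≤ 1 ∧ 0 < κ₁ ∧ 0 ≤ M ∧
      768 * Fintype.card (DirPair d) * Mτ * Mφ ^ 2 * ρw * α₀ < γ / 2 ∧
      ∀ (n : ℕ) (η : ℝ), η * (L : ℝ) ^ (n + 1) = 1 →
      ∀ (c₀ c₁ : ℝ) [Fact (0 < c₀)] [Fact (0 < c₁)], c₀ * ((L : ℝ) ^ (n + 1)) ^ d = c₁ → |η| ^ d / c₀ ≤ ρw →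
      ∀ (m : Fin d → ℕ) [∀ i, NeZero (m i)] (U : Bond d (towerP L m (n + 1)) → 𝔸ˣ) (αU : ℕ → ℝ) (hα1 : ∀ j, αU j ≤ 1 / 64)
        (hU1 : ∀ (j : ℕ) (x : B7Prop1Explicit.Site d) (κ : Fin d), perCfg (towerP L m (j + 1)) (UlevOf L m (n + 1) U j) x κ ∈ U1 𝔸)
        (hreg : ∀ (j : ℕ) (y : TSite d (towerP L m j)) (κ : Fin d) (r : Fin d → Fin L),
          ‖((Wcx L (perCfg (towerP L m (j + 1)) (UlevOf L m (n + 1) U j)) (cornerSite L y) κ (boxVec L r) : 𝔸ˣ) : 𝔸) - 1‖ ≤ αU j)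
        (εU : ℕ → ℝ), (∀ j, 0 ≤ εU j) → (∀ (j : ℕ) (b : Bond d (towerP L m (j + 1))), ‖(UlevOf L m (n + 1) U j b : 𝔸) - 1‖ ≤ εU j) →
        (∀ (j : ℕ) (b : Bond d (towerP L m (j + 1))), UlevOf L m (n + 1) U j b ∈ U1 𝔸) →
      ∀ {α : ℝ}, 0 ≤ α → α ≤ α₀ →
        (∀ b, star (U b : 𝔸) = (((U b)⁻¹ : 𝔸ˣ) : 𝔸)) →
        (∀ b, U b ∈ U1 𝔸) → (∀ b, ‖(U b : 𝔸) - 1‖ ≤ α * η) →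
        (∀ p : B9SectCLatticeCarrier.Plaq d (towerP L m (n + 1)), ‖(plaqHolU U p : 𝔸) - 1‖ ≤ α * η ^ 2) →
        (∀ j < n + 1, εU j ≤ α * ϱ ^ j) →
        (∀ x : BondL2K ℂ d (towerP L m (n + 1)) c₀ W,
            γ * ‖x‖ ^ 2 ≤ RCLike.re ⟪x, laplaceAk L m n φ η U hL αU hα1 hU1 hreg τ (c₀ := c₀) (c₁ := c₁) a x⟫_ℂ) ∧
        (∀ (hpos : ∀ x : BondL2K ℂ d (towerP L m (n + 1)) c₀ W, x ≠ 0 →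
              0 < RCLike.re ⟪x, laplaceAk L m n φ η U hL αU hα1 hU1 hreg τ (c₀ := c₀) (c₁ := c₁) a x⟫_ℂ)
            (hQ : Function.Surjective (QkW L m n φ U hL αU hα1 hU1 hreg (c₀ := c₀) (c₁ := c₁))) (g : BondL2K ℂ d m c₁ W),
            μ₁ * ‖g‖ ^ 2 ≤ RCLike.re ⟪g, QkW L m n φ U hL αU hα1 hU1 hreg (c₀ := c₀) (c₁ := c₁)
              (G1k L m n φ η U hL αU hα1 hU1 hreg τ (c₀ := c₀) (c₁ := c₁) hpos
                (LinearMap.adjoint (QkW L m n φ U hL αU hα1 hU1 hreg (c₀ := c₀) (c₁ := c₁)) g))⟫_ℂ) ∧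
        (∀ x : SiteL2K ℂ d (towerP L m (n + 1)) c₀ W, x ≠ 0 → 0 < RCLike.re ⟪x, laplacePrimeAk L m n φ η U a' (c₁ := c₁) x⟫_ℂ) ∧
        (∀ f : SiteL2K ℂ d (towerP L m (n + 1)) c₀ W, γ' * ‖f‖ ^ 2 ≤ ‖(covDerivL2K ℂ c₀ ((η : ℂ))⁻¹ (adTransportW φ U)) f‖ ^ 2 +
            a' * ‖((WL2.linearEquiv ℂ ℂ (fun _ : TSite d m => c₁)).symm.toLinearMap ∘ₗ QprimeTowerW L m n φ U (c₀ := c₀)) f‖ ^ 2) ∧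
        (∀ (hpos' : ∀ x : SiteL2K ℂ d (towerP L m (n + 1)) c₀ W, x ≠ 0 → 0 < RCLike.re ⟪x, laplacePrimeAk L m n φ η U a' (c₁ := c₁) x⟫_ℂ)
            (ψ : SiteL2K ℂ d m c₁ W), κ₁ * ‖ψ‖ ^ 2 ≤ RCLike.re ⟪ψ,
            (((WL2.linearEquiv ℂ ℂ (fun _ : TSite d m => c₁)).symm.toLinearMap ∘ₗ QprimeTowerW L m n φ U (c₀ := c₀)) ∘ₗ GpOfUk L m n φ η U a' (c₁ := c₁) hpos' ∘ₗ GpOfUk L m n φ η U a' (c₁ := c₁) hpos' ∘ₗ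
              LinearMap.adjoint ((WL2.linearEquiv ℂ ℂ (fun _ : TSite d m => c₁)).symm.toLinearMap ∘ₗ QprimeTowerW L m n φ U (c₀ := c₀))) ψ⟫_ℂ) ∧
        (∀ s : SiteL2K ℂ d (towerP L m (n + 1)) c₀ W, ‖((WL2.linearEquiv ℂ ℂ (fun _ : TSite d m => c₁)).symm.toLinearMap ∘ₗ QprimeTowerW L m n φ U (c₀ := c₀)) s‖ ≤ M * ‖s‖) ∧
        (∀ p : B9SectCLatticeCarrier.Plaq d (towerP L m (n + 1)), ‖reHol U p - 1‖ ≤ α * η ^ 2) ∧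
        (∀ p : B9SectCLatticeCarrier.Plaq d (towerP L m (n + 1)), ‖imHol U p‖ ≤ α * η ^ 2) ∧
        (768 * Fintype.card (DirPair d) * Mτ * Mφ ^ 2 * (‖((η : ℂ)) ^ d‖ / c₀) * ‖((η : ℂ))⁻¹‖ ^ 2 * (α * η ^ 2)) ≤ 768 * Fintype.card (DirPair d) * Mτ * Mφ ^ 2 * ρw * α₀ := by
  have hL0 : (0 : ℝ) < L := by exact_mod_cast (lt_of_lt_of_le (by norm_num) hL3 : 0 < L)
  -- the five suppliers, `∃`-first
  obtain ⟨αγ, γ₁, hαγ, hγ₁, Hγ⟩ := exists_coercive_laplaceAk_diagonal_closed (d := d) L hL φ hMφ hMφ' hφ hφ' ha hϱ0 hϱ1 τ hτ hCτ hρw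
  obtain ⟨αμ, μ₁, hαμ, hμ₁, Hμ⟩ := exists_X1_floor_diagonal_closed hd L hL φ hMφ hMφ' hφ hφ' ha hϱ0 hϱ1 τ hτ hCτ hρw hτ₁ hτ₂ hφτ
  obtain ⟨κ, hκ, Hκ0⟩ := exists_qggq_coercive_tower_diagonal_closed (d := d) (𝔸 := 𝔸) φ ha' hMφ hMφ' hφ hφ'
  obtain ⟨ακ, hακ, Hκ⟩ := Hκ0 L hL3 ϱ hϱ0 hϱ1
  obtain ⟨ασ, γσ, hασ, hγσ, Hσ⟩ := exists_strong_site_coercive_tower_diagonal (d := d) (𝔸 := 𝔸) L φ hMφ hMφ' hφ hφ' ha' hϱ0 hϱ1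
  -- the curvature gap threshold
  set P : ℝ := 768 * Fintype.card (DirPair d) * Mτ * Mφ ^ 2 * ρw with hP
  have hP0 : 0 ≤ P := by positivity
  set αp : ℝ := min γ₁ 1 / (4 * (P + 1)) with hαp
  have hαp0 : 0 < αp := by positivity
  set α₀ : ℝ := min (min αγ αμ) (min (min ακ ασ) αp) with hα₀
  have hα₀γ : α₀ ≤ αγ := (min_le_left _ _).trans (min_le_left _ _)
  have hα₀μ : α₀ ≤ αμ := (min_le_left _ _).trans (min_le_right _ _)
  have hα₀κ : α₀ ≤ ακ := (min_le_right _ _).trans ((min_le_left _ _).trans (min_le_left _ _))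
  have hα₀σ : α₀ ≤ ασ := (min_le_right _ _).trans ((min_le_left _ _).trans (min_le_right _ _))
  have hα₀p : α₀ ≤ αp := (min_le_right _ _).trans (min_le_right _ _)
  have hα₀0 : 0 < α₀ := lt_min (lt_min hαγ hαμ) (lt_min (lt_min hακ hασ) hαp0)
  set M : ℝ := Real.exp (((d * (L - 1) : ℕ) : ℝ) * (2 * Mφ * Mφ' * α₀ / (1 - ϱ))) with hM
  have hgap : P * α₀ < min γ₁ 1 / 2 := by
    have h1 : P * α₀ ≤ P * αp := mul_le_mul_of_nonneg_left hα₀p hP0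
    have h2 : P * αp ≤ (P + 1) * αp := mul_le_mul_of_nonneg_right (by linarith) hαp0.le
    have h3 : (P + 1) * αp = min γ₁ 1 / 4 := by rw [hαp]; field_simp
    have h4 : 0 < min γ₁ 1 := lt_min hγ₁ one_pos
    linarith
  refine ⟨α₀, min γ₁ 1, μ₁, min γσ 1, κ, M, hα₀0, lt_min hγ₁ one_pos, min_le_right _ _, hμ₁, lt_min hγσ one_pos, min_le_right _ _, hκ,
    (Real.exp_pos _).le, by rw [hP] at hgap; exact hgap, ?_⟩
  intro n η hηL c₀ c₁ _ _ hw hρ m _ U αU hα1 hU1 hreg εU hεU hUε hLb α hα0 hαle hUst hUb hUη hpl hεg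
  have hc₀ : 0 < c₀ := Fact.out
  have hη0 : 0 < η := by
    have hLp : (0 : ℝ) < (L : ℝ) ^ (n + 1) := by positivity
    by_contra h
    have : η * (L : ℝ) ^ (n + 1) ≤ 0 := mul_nonpos_of_nonpos_of_nonneg (not_lt.mp h) hLp.le
    linarith
  have hRS : ∀ (b : Bond d (towerP L m (n + 1))) (v u : W), ⟪adTransportW φ U b v, u⟫_ℂ = ⟪v, adTransportW φ (fun b => (U b)⁻¹) b u⟫_ℂ :=
    adTransportW_adjoint φ τ hτ₂ hUst hφτ
  have hL3n : 3 ≤ L ^ (n + 1) := le_trans hL3 (Nat.le_self_pow (Nat.succ_ne_zero n) L)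
  refine ⟨?_, ?_, ?_, ?_, ?_, ?_, ?_, ?_, ?_⟩
  · -- (γ)
    intro x
    have h := Hγ n η hηL c₀ c₁ hw hρ m U αU hα1 hU1 hreg εU hεU hUε hα0 (hαle.trans hα₀γ) hRS hUb hUη hpl hεg x
    have h0 : 0 ≤ ‖x‖ ^ 2 := sq_nonneg _
    exact (mul_le_mul_of_nonneg_right (min_le_left _ _) h0).trans h
  · -- (μ₁)
    intro hpos hQ g
    exact Hμ n η hηL hL3n c₀ c₁ hw hρ m U αU hα1 hU1 hreg εU hεU hUε hα0 (hαle.trans hα₀μ) hUst hUb hUη hpl hεg hpos hQ g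
  · -- (pos′)
    exact (Hκ n η hηL c₀ c₁ hw m U hRS α hα0 (hαle.trans hα₀κ) hUb hUη εU hεU hεg hUε hLb).1
  · -- (γ′)
    intro f
    have h := Hσ n η hηL c₀ c₁ hw m U hRS α hα0 (hαle.trans hα₀σ) hUb hUη εU hεU hεg hUε hLb f
    rw [re_inner_laplacePrimeAk L m n φ η U a' (c₁ := c₁) hRS f] at h
    have hD0 : 0 ≤ ‖covDerivL2K ℂ c₀ ((η : ℂ))⁻¹ (adTransportW φ (fun _ : Bond d (towerP L m (n + 1)) => (1 : 𝔸ˣ))) f‖ ^ 2 := sq_nonneg _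
    have h0 : 0 ≤ ‖f‖ ^ 2 := sq_nonneg _
    have h1 : min γσ 1 * ‖f‖ ^ 2 ≤ γσ * ‖f‖ ^ 2 := mul_le_mul_of_nonneg_right (min_le_left _ _) h0
    nlinarith [h, h1, mul_nonneg hγσ.le hD0]
  · -- (κ₁)
    exact (Hκ n η hηL c₀ c₁ hw m U hRS α hα0 (hαle.trans hα₀κ) hUb hUη εU hεU hεg hUε hLb).2
  · -- (M)
    intro s
    have h1 := norm_QtildeTower_one_le L m n φ (c₀ := c₀) c₁ s
    have h2 := norm_QtildeTower_sub_flat_le L m n φ hMφ hMφ' hφ hφ' (c₀ := c₀) c₁ U εU hεU hUε hLb s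
    have hW1 : Real.sqrt (c₁ / (c₀ * ((L : ℝ) ^ (n + 1)) ^ d)) = 1 := by
      rw [← hw, div_self (by positivity), Real.sqrt_one]
    rw [hW1] at h1 h2
    have hK : (0 : ℝ) ≤ 2 * Mφ * Mφ' := by positivity
    have hρ := rhoTower_le_exp_sub_one n hK hϱ0 hϱ1 hα0 εU hεU hεg (d * (L - 1))
    have hmono : Real.exp (((d * (L - 1) : ℕ) : ℝ) * (2 * Mφ * Mφ' * α / (1 - ϱ))) ≤ M := by
      rw [hM]; apply Real.exp_le_exp.mpr
      apply mul_le_mul_of_nonneg_left _ (by positivity)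
      exact div_le_div_of_nonneg_right (mul_le_mul_of_nonneg_left hαle hK) (by linarith)
    set ρk : ℝ := (∏ j ∈ Finset.range (n + 1), (1 + 2 * Mφ * Mφ' * εU j) ^ (d * (L - 1))) - 1 with hρk
    have htri := norm_le_norm_add_norm_sub' (((WL2.linearEquiv ℂ ℂ (fun _ : TSite d m => c₁)).symm.toLinearMap ∘ₗ QprimeTowerW L m n φ U (c₀ := c₀)) s)
      (((WL2.linearEquiv ℂ ℂ (fun _ : TSite d m => c₁)).symm.toLinearMap ∘ₗ
          QprimeTowerW L m n φ (fun _ : Bond d (towerP L m (n + 1)) => (1 : 𝔸ˣ)) (c₀ := c₀)) s)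
    have hs0 : 0 ≤ ‖s‖ := norm_nonneg _
    have h1' : ‖((WL2.linearEquiv ℂ ℂ (fun _ : TSite d m => c₁)).symm.toLinearMap ∘ₗ
          QprimeTowerW L m n φ (fun _ : Bond d (towerP L m (n + 1)) => (1 : 𝔸ˣ)) (c₀ := c₀)) s‖ ≤ ‖s‖ := by simpa only [one_mul] using h1
    have h2' : ‖((WL2.linearEquiv ℂ ℂ (fun _ : TSite d m => c₁)).symm.toLinearMap ∘ₗ QprimeTowerW L m n φ U (c₀ := c₀)) s -
        ((WL2.linearEquiv ℂ ℂ (fun _ : TSite d m => c₁)).symm.toLinearMap ∘ₗ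
          QprimeTowerW L m n φ (fun _ : Bond d (towerP L m (n + 1)) => (1 : 𝔸ˣ)) (c₀ := c₀)) s‖ ≤ ρk * ‖s‖ := by
      simpa only [mul_one] using h2
    have h3 : ρk * ‖s‖ ≤ (M - 1) * ‖s‖ := mul_le_mul_of_nonneg_right (by linarith [hρ, hmono]) hs0
    calc ‖((WL2.linearEquiv ℂ ℂ (fun _ : TSite d m => c₁)).symm.toLinearMap ∘ₗ QprimeTowerW L m n φ U (c₀ := c₀)) s‖ ≤ ‖s‖ + ρk * ‖s‖ := by linarith [htri, h1', h2']
      _ ≤ ‖s‖ + (M - 1) * ‖s‖ := by linarith [h3]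
      _ = M * ‖s‖ := by ring
  · -- (Re)
    exact fun p => norm_reHol_sub_one_le (hU := hUb) (hpl p)
  · -- (Im)
    exact fun p => norm_imHol_le (hU := hUb) (hpl p)
  · -- (p_K)
    have hηn : ‖((η : ℂ)) ^ d‖ / c₀ ≤ ρw := by
      rw [norm_pow, Complex.norm_real, Real.norm_eq_abs]; exact hρ
    have hηinv : ‖((η : ℂ))⁻¹‖ ^ 2 * (α * η ^ 2) = α := by
      rw [norm_inv, Complex.norm_real, Real.norm_eq_abs, abs_of_pos hη0]
      field_simp
    have hnn : 0 ≤ ‖((η : ℂ)) ^ d‖ / c₀ := by positivity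
    calc (768 * Fintype.card (DirPair d) * Mτ * Mφ ^ 2 * (‖((η : ℂ)) ^ d‖ / c₀) * ‖((η : ℂ))⁻¹‖ ^ 2 * (α * η ^ 2)) = 768 * Fintype.card (DirPair d) * Mτ * Mφ ^ 2 * (‖((η : ℂ)) ^ d‖ / c₀) * (‖((η : ℂ))⁻¹‖ ^ 2 * (α * η ^ 2)) := by ring
      _ = 768 * Fintype.card (DirPair d) * Mτ * Mφ ^ 2 * (‖((η : ℂ)) ^ d‖ / c₀) * α := by rw [hηinv]
      _ ≤ 768 * Fintype.card (DirPair d) * Mτ * Mφ ^ 2 * ρw * α₀ := by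
        apply mul_le_mul (mul_le_mul_of_nonneg_left hηn (by positivity)) hαle hα0 (by positivity)

end Literature.MathematicalPhysics.QuantumFieldTheory.Balaban1983to89.B9Eq3126H1RowLettersDiagonalClosed

end
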